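import Summits.QuantumFields.YangMills.Theorems.UnitScaleTiltProp7SectET3T47DfixBridge
import Summits.QuantumFields.YangMills.Theorems.UnitScaleTiltProp7SectET3CurvedPropagatorsT3Rows
import Summits.QuantumFields.YangMills.Theorems.UnitScaleTiltProp7SectET3DeltaPiT3
import Summits.QuantumFields.YangMills.Theorems.UnitScaleTiltProp7SymAvgTwSymDefs
import HarnessLib

/-!
# Route `UnitScaleTilt`, crux K1 child «MinimiserStabilityRegPr» (stmt-QuantumFields-19200), stub `stub_existenceMinimalOrbit` (EX), route (α) —
# «EMAP-DFIX AT (W-X′)» (EX namer ★w2-19200 g6 2026-08-28T19:50:28Z (G22)): **THE Sect. C SELECTOR INSIDE `W80` AT THE (W-X′) LETTERS OF RECORD IS CONJUGATE, ON THE NOSE, TO THE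
# EX DISPLAY'S CHART** — `κ_f • ι(HD(A′)) = H46 U₀ (Dfix (CmapTwS U₀) (H46 U₀) C₂ (κ_f • ιA′))` and `κ_f • ι(T47 A′) = χ(κ_f • ιA′)`, `χ X = X − H46 U₀ (Dfix … X)`, `κ_f := (η:ℂ)·I`

Cell `ym3-torus`, width seat `ym3-torus-px14` (gen 2; LOCATE «WF-LETTERS» `ym3-torus-px14/LOCATE-WF-LETTERS-px14g2.md` §5).  THEOREMS ONLY (0 `def`, 0 `sorry`).  `--supports stmt-QuantumFields-19200
--as helper`, count-neutral.  YM₃ on T³ is a ladder rung (R3), not the Clay problem; nothing here claims the stub, the crux, d = 4 or the mass gap.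

THE PRINT.  [Balaban1985Variational] p. 285: «A = A′ − HD(A′), (47) … H D(A′) = A′ − A, (48) … C_j(LʲηA′ − LʲηHD(A′)) = D(A′). (49)»; p. 290 (80), p. 291 (85)–(89): every term of `W = (δ∕δA′)V`
reads `HD(A′)`.  THE LETTERS OF RECORD (W-X′) (EX namer, units word 19:50:28Z): A-UNITS throughout on the space (115) with the two conversion factors of the knit explicit — fine `κ_f := (η:ℂ)·I`
(S9's `A′ = ((η:ℂ)·I) • ι(A₁ + H₁B̃)`) and coarse `κ_c := I`; `H̃ := H1f …Δ_π… U₀` (✓`Prop7SectET3CurvedPropagators.H1f`), **`C̃ U₀ := fun A′ ↦ (−I) • CmapTwS F n K h U₀ (κ_f • ιA′)`**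
(`= κ_c⁻¹ • CmapTwS (κ_f • ιA′)`), `ι A′ := fun b ↦ JetSup.equiv _ _ _ A′ (bondEquiv F K b)` (the 0-jet reading on the route's bonds, S9's text).  `W80`'s inside uses lit's selector
`Emap H̃ C̃ εC A′ = HD(A′)`, `T47 H̃ C̃ εC A′ = A′ − HD(A′)` (✓`B11Eq174Chart.solA`); S9's `hCrit93′`∕`hSplit′` write the chart at exponent level through `B11Prop3Model.Dfix (CmapTwS U₀) (H46 U₀) C₂`.

WHAT IS PROVED (sorry-free, no definition; composition BY NAME of ★px18 g2's ✓`Prop7T47DfixBridge` with the member letters).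
* §1 **`smul_iota_H1f_eq_H46_smul`** — THE UNITS IDENTITY `κ_f • ι(H1f … X′) = H46 U₀ (I • X′)` (`H46 = η • toL2⁻¹∘HT∘toL2B` vs `ι∘H1f = toL2⁻¹∘HT∘toL2B`: ✓`iota_H1f_eq`, ✓`Hf_apply`);
  `iotaL_apply` (the 0-jet reading as a linear map, by `rfl`); `smul_Ctilde_eq` (`I • C̃ B′ = CmapTwS (κ_f • ιB′)`).
* §2 ★★ **`smul_iota_Dfix_eq`** — `I • Dfix C̃ H̃ C₂′ A′ = Dfix (CmapTwS U₀) (H46 U₀) C₂ (κ_f • ιA′)` on `‖A′‖ < ε′`, `‖κ_f • ιA′‖ < ε` (✓`map_Dfix_eq_Dfix_of_conj` with `r := κ_f • ι`, `s := I •`,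
  `σ = 1`; both B13 regimes and the nesting `4C₂′ε′² ≤ 4C₂ε²` DISPLAYED).
* §3 ★★★ **`smul_iota_Emap_eq_H46_Dfix`** («EMAP-DFIX» (a)) — `κ_f • ι(Emap H̃ C̃ εC A′) = H46 U₀ (Dfix (CmapTwS U₀) (H46 U₀) C₂ (κ_f • ιA′))`, and ★★★ **`smul_iota_T47_eq_chart`** ((b)) —
  `κ_f • ι(T47 H̃ C̃ εC A′) = κ_f • ιA′ − H46 U₀ (Dfix (CmapTwS U₀) (H46 U₀) C₂ (κ_f • ιA′))` (S9's chart `χ` at `X := κ_f • ιA′`), under the Sect. C regime `Regime H̃ 0 C̃ b 0 C₂ᵣ c₄ 0 aC εC`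
  (its `norm_G` IS S9's `norm_H₁` row), `QuadAnalytic C̃ C₂′ R′` (px3 (G19′) «WF-P4-ROWS»: `C₂′ = K_L`-class, `R′ = ε′`-class, η-FREE), `QuadAnalytic (CmapTwS U₀) C₂ R` with `‖H46 X‖ ≤ b₂‖X‖`
  (✓`Prop7CmapTwSymInputs.inputs_CmapTwS`: `C₂ = 40·(2·(3·(2e + 2700Lε₀)))∕(eη)²`, `R = eη∕2`-class, `b₂ = B₀η`), the contraction numerics `9C₂′bε′ < 1`, `3ε′ ≤ R′`, `9C₂b₂ε < 1`, `3ε ≤ R`,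
  the two nesting windows `4C₂′bε′² ≤ εC`, `4C₂′ε′² ≤ 4C₂ε²`, and the radii `‖A′‖ < aC`, `‖A′‖ < ε′`, `‖κ_f • ιA′‖ < ε` — ALL DISPLAYED (constants are letters; the docstring names the suppliers).
HONEST SCOPE.  Uniqueness bookkeeping over landed selectors; no estimate; `C̃`'s `QuadAnalytic` row and the windows are NOT discharged here (px3 ∕ the knit); nothing of EX, the crux, d = 4 or
the mass gap is claimed.

References: T. Bałaban, CMP **102** (1985) 277–309 [Balaban1985Variational] ((44)–(49) p.285, (55) p.286, (80) p.290, (85)–(89) p.291, (103) p.293, Prop. 6 p.295).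
-/

set_option autoImplicit false

noncomputable section

open scoped Matrix.Norms.L2Operator

namespace Summit.QuantumFields.YangMills.Theorems.Prop7SectET3WChartConj

open Literature.MathematicalPhysics.QuantumFieldTheory.Balaban1983to89
open Literature.MathematicalPhysics.QuantumFieldTheory.Balaban1983to89.T3ContinuumYM3Torus
open T3SectALandauChart (eta eta_pos)
open B9SectCLatticeCarrier (Bond)
open B11Eq115Space (NegSup NegSize Space115 JetSup)
open B11Eq111FrakG (nabla115)
open B13Contraction113 (QuadAnalytic)
open B11Eq174Chart (Regime)
open B11Eq90V0primeCurrent (flat115 flat115_apply)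
open B11Eq90V0GroupComposed (T47)
open B11Eq80Current (Emap Emap_eq_sub)
open B11Prop3Model (Dfix)
open Summit.QuantumFields.YangMills.Theorems.Prop7SectET3Transport (periodsT3 bondEquiv bgOfCfg)
open Summit.QuantumFields.YangMills.Theorems.Prop7SectET3HilbertLetters (toL2)
open Summit.QuantumFields.YangMills.Theorems.Prop7SymAvgTwSym (CmapTwS)
open Summit.QuantumFields.YangMills.Theorems.Prop7SectET3CurvedPropagators (H1f HT Hf_apply iota_H1f_eq)
open Summit.QuantumFields.YangMills.Theorems.Prop7SectET3DeltaPi (DeltaPiSlot H46)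
open Summit.QuantumFields.YangMills.Theorems.Prop7T47DfixBridge (Emap_eq_Dfix map_Dfix_eq_Dfix_of_conj)

variable (F : T3Family) (n K : ℕ) (h : n ≤ K) (c₀ cB a : ℝ) [Fact (0 < c₀)] [Fact (0 < cB)] [Fact (0 < (F.L : ℝ))] [Fact (0 < ((F.L : ℝ)⁻¹) ^ (K - n))]
  (U₀ : GaugeField (F.P K) 0 (Matrix.specialUnitaryGroup (Fin 2) ℂ))

/-! ## §1 The 0-jet reading as a linear map, and the units identity `κ_f • ι(H1f X′) = H46 (I • X′)` -/

/-- **THE 0-JET READING IS LINEAR**: `(funLeft (bondEquiv F K) ∘ flat115) A′ = fun b ↦ JetSup.equiv _ _ _ A′ (bondEquiv F K b)` — S9's `ι` text as a `LinearMap` application (by `rfl`).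
[cite: Balaban1985Variational, (115) p.294, (103) p.293] -/
theorem iotaL_apply
    (A' : Space115 (F.L : ℝ) (((F.L : ℝ)⁻¹) ^ (K - n)) (fun _ : Bond 3 (periodsT3 F K) => K - n)
      (fun _ : Bond 3 (periodsT3 F K) × Fin 3 => K - n) (nabla115 (((F.L : ℝ)⁻¹) ^ (K - n)) (bgOfCfg F K U₀))) :
    ((LinearMap.funLeft ℂ (Matrix (Fin 2) (Fin 2) ℂ) (bondEquiv F K)) ∘ₗ
        ((flat115 : Space115 (F.L : ℝ) (((F.L : ℝ)⁻¹) ^ (K - n)) (fun _ : Bond 3 (periodsT3 F K) => K - n)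
          (fun _ : Bond 3 (periodsT3 F K) × Fin 3 => K - n) (nabla115 (((F.L : ℝ)⁻¹) ^ (K - n)) (bgOfCfg F K U₀)) →L[ℂ]
            (Bond 3 (periodsT3 F K) → Matrix (Fin 2) (Fin 2) ℂ)) :
          Space115 (F.L : ℝ) (((F.L : ℝ)⁻¹) ^ (K - n)) (fun _ : Bond 3 (periodsT3 F K) => K - n)
            (fun _ : Bond 3 (periodsT3 F K) × Fin 3 => K - n) (nabla115 (((F.L : ℝ)⁻¹) ^ (K - n)) (bgOfCfg F K U₀)) →ₗ[ℂ]
              (Bond 3 (periodsT3 F K) → Matrix (Fin 2) (Fin 2) ℂ))) A'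
      = fun b : PBond (F.P K) 0 => JetSup.equiv _ _ _ A' (bondEquiv F K b) := rfl

/-- ★ **THE UNITS IDENTITY OF (W-X′)**: `((η:ℂ)·I) • ι(H1f …Δ_π… U₀ X′) = H46 U₀ (I • X′)` — the A-units (115)-letter `H₁f` and the exponent-units route letter `H46 = η • toL2⁻¹∘HT∘toL2B` read the SAME
total `H(U₀)` (✓`iota_H1f_eq`, ✓`Hf_apply`). [cite: Balaban1985Variational, (45)–(46) p.285, (103) p.293; Balaban1985BackgroundPropagators, (3.126) p.420] -/
theorem smul_iota_H1f_eq_H46_smul (X' : PBond (F.P n) 0 → Matrix (Fin 2) (Fin 2) ℂ) :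
    ((((eta F n K : ℝ) : ℂ)) * Complex.I) • (fun b : PBond (F.P K) 0 => JetSup.equiv _ _ _ (H1f F n K h c₀ cB a (DeltaPiSlot F n K h c₀ cB a) U₀ X') (bondEquiv F K b))
      = H46 F n K h c₀ cB a U₀ (Complex.I • X') := by
  rw [iota_H1f_eq, H46, map_smul, Hf_apply, smul_smul, mul_comm]

omit [Fact (0 < (F.L : ℝ))] [Fact (0 < ((F.L : ℝ)⁻¹) ^ (K - n))] in
/-- **`κ_c • C̃ = CmapTwS ∘ (κ_f • ι)`**: `I • ((−I) • CmapTwS U₀ Y) = CmapTwS U₀ Y`. [cite: Balaban1985Variational, (44) p.285] -/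
theorem smul_Ctilde_eq (Y : PBond (F.P K) 0 → Matrix (Fin 2) (Fin 2) ℂ) :
    Complex.I • ((-Complex.I) • CmapTwS F n K h U₀ Y) = CmapTwS F n K h U₀ Y := by
  rw [smul_smul, mul_neg, Complex.I_mul_I, neg_neg, one_smul]

/-! ## §2 ★★ The two `Dfix` selections are conjugate: `I • Dfix C̃ H̃ C₂′ A′ = Dfix (CmapTwS U₀) (H46 U₀) C₂ (κ_f • ιA′)` -/

/-- ★★ **THE TWO SELECTORS ARE CONJUGATE ON THE NOSE** (✓`Prop7T47DfixBridge.map_Dfix_eq_Dfix_of_conj` at `r := κ_f • ι`, `s := I •`, `σ := 1`): with the A-units chart remainder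
`C̃ := fun A′ ↦ (−I) • CmapTwS U₀ (κ_f • ιA′)` and `H̃ := H1f …Δ_π… U₀`, under both B13 contraction regimes and the nesting window, `I • Dfix C̃ ↑H̃ C₂′ A′ = Dfix (CmapTwS U₀) (H46 U₀) C₂ (κ_f • ιA′)`.
[cite: Balaban1985Variational, (49) p.285, (55) p.286] -/
theorem smul_iota_Dfix_eq {C₂ R b₂ ε C₂' R' b' ε' : ℝ}
    (hC : QuadAnalytic (CmapTwS F n K h U₀) C₂ R) (hC₂ : 0 ≤ C₂) (hb₂ : 0 ≤ b₂) (hHop : ∀ X, ‖H46 F n K h c₀ cB a U₀ X‖ ≤ b₂ * ‖X‖)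
    (hq : 9 * C₂ * b₂ * ε < 1) (hRC : 3 * ε ≤ R)
    (hC' : QuadAnalytic (fun A' : Space115 (F.L : ℝ) (((F.L : ℝ)⁻¹) ^ (K - n)) (fun _ : Bond 3 (periodsT3 F K) => K - n)
        (fun _ : Bond 3 (periodsT3 F K) × Fin 3 => K - n) (nabla115 (((F.L : ℝ)⁻¹) ^ (K - n)) (bgOfCfg F K U₀)) =>
          (-Complex.I) • CmapTwS F n K h U₀ (((((eta F n K : ℝ) : ℂ)) * Complex.I) • fun b : PBond (F.P K) 0 => JetSup.equiv _ _ _ A' (bondEquiv F K b))) C₂' R')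
    (hC₂' : 0 ≤ C₂') (hb' : 0 ≤ b') (hHop' : ∀ X', ‖H1f F n K h c₀ cB a (DeltaPiSlot F n K h c₀ cB a) U₀ X'‖ ≤ b' * ‖X'‖)
    (hq' : 9 * C₂' * b' * ε' < 1) (hRC' : 3 * ε' ≤ R') (hnest : 4 * C₂' * ε' ^ 2 ≤ 4 * C₂ * ε ^ 2)
    {A' : Space115 (F.L : ℝ) (((F.L : ℝ)⁻¹) ^ (K - n)) (fun _ : Bond 3 (periodsT3 F K) => K - n)
        (fun _ : Bond 3 (periodsT3 F K) × Fin 3 => K - n) (nabla115 (((F.L : ℝ)⁻¹) ^ (K - n)) (bgOfCfg F K U₀))}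
    (hA' : ‖A'‖ < ε') (hA : ‖((((eta F n K : ℝ) : ℂ)) * Complex.I) • (fun b : PBond (F.P K) 0 => JetSup.equiv _ _ _ A' (bondEquiv F K b))‖ < ε) :
    Complex.I • Dfix (fun A' : Space115 (F.L : ℝ) (((F.L : ℝ)⁻¹) ^ (K - n)) (fun _ : Bond 3 (periodsT3 F K) => K - n)
        (fun _ : Bond 3 (periodsT3 F K) × Fin 3 => K - n) (nabla115 (((F.L : ℝ)⁻¹) ^ (K - n)) (bgOfCfg F K U₀)) =>
          (-Complex.I) • CmapTwS F n K h U₀ (((((eta F n K : ℝ) : ℂ)) * Complex.I) • fun b : PBond (F.P K) 0 => JetSup.equiv _ _ _ A' (bondEquiv F K b)))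
        (H1f F n K h c₀ cB a (DeltaPiSlot F n K h c₀ cB a) U₀ : (PBond (F.P n) 0 → Matrix (Fin 2) (Fin 2) ℂ) →ₗ[ℂ] _) C₂' A'
      = Dfix (CmapTwS F n K h U₀) (H46 F n K h c₀ cB a U₀) C₂
          (((((eta F n K : ℝ) : ℂ)) * Complex.I) • fun b : PBond (F.P K) 0 => JetSup.equiv _ _ _ A' (bondEquiv F K b)) := by
  -- the conjugating maps: `r := κ_f • ι` (A-units (115) → exponent-units route functions), `s := I •` on the B-fields
  have key := map_Dfix_eq_Dfix_of_conj (C := CmapTwS F n K h U₀) (hop := (H46 F n K h c₀ cB a U₀))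
    (C' := fun A' : Space115 (F.L : ℝ) (((F.L : ℝ)⁻¹) ^ (K - n)) (fun _ : Bond 3 (periodsT3 F K) => K - n)
        (fun _ : Bond 3 (periodsT3 F K) × Fin 3 => K - n) (nabla115 (((F.L : ℝ)⁻¹) ^ (K - n)) (bgOfCfg F K U₀)) =>
          (-Complex.I) • CmapTwS F n K h U₀ (((((eta F n K : ℝ) : ℂ)) * Complex.I) • fun b : PBond (F.P K) 0 => JetSup.equiv _ _ _ A' (bondEquiv F K b)))
    (hop' := (H1f F n K h c₀ cB a (DeltaPiSlot F n K h c₀ cB a) U₀ : (PBond (F.P n) 0 → Matrix (Fin 2) (Fin 2) ℂ) →ₗ[ℂ] _))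
    (((((eta F n K : ℝ) : ℂ)) * Complex.I) • ((LinearMap.funLeft ℂ (Matrix (Fin 2) (Fin 2) ℂ) (bondEquiv F K)) ∘ₗ
        ((flat115 : Space115 (F.L : ℝ) (((F.L : ℝ)⁻¹) ^ (K - n)) (fun _ : Bond 3 (periodsT3 F K) => K - n)
          (fun _ : Bond 3 (periodsT3 F K) × Fin 3 => K - n) (nabla115 (((F.L : ℝ)⁻¹) ^ (K - n)) (bgOfCfg F K U₀)) →L[ℂ]
            (Bond 3 (periodsT3 F K) → Matrix (Fin 2) (Fin 2) ℂ)) : _ →ₗ[ℂ] _)))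
    (Complex.I • (LinearMap.id : (PBond (F.P n) 0 → Matrix (Fin 2) (Fin 2) ℂ) →ₗ[ℂ] _))
    (fun B' => by rw [LinearMap.smul_apply, LinearMap.id_apply, smul_Ctilde_eq, LinearMap.smul_apply, iotaL_apply])
    (fun X' => by
      simp only [LinearMap.smul_apply, LinearMap.id_apply, iotaL_apply, ContinuousLinearMap.coe_coe]
      exact smul_iota_H1f_eq_H46_smul F n K h c₀ cB a U₀ X')
    zero_le_one (fun X' => by rw [LinearMap.smul_apply, LinearMap.id_apply, norm_smul, Complex.norm_I])
    hC hC₂ hb₂ hHop hq hRC hC' hC₂' hb' (fun X' => by simpa only [ContinuousLinearMap.coe_coe] using hHop' X') hq' hRC' (by rwa [one_mul]) hA'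
    (by rwa [LinearMap.smul_apply, iotaL_apply])
  rwa [LinearMap.smul_apply, LinearMap.id_apply, LinearMap.smul_apply, iotaL_apply] at key

/-! ## §3 ★★★ «EMAP-DFIX»: the selector inside `W80` at (W-X′) IS the EX display's chart, on the nose -/

/-- ★★★ **«EMAP-DFIX» (a): `κ_f • ι(HD(A′)) = H46 U₀ (Dfix (CmapTwS U₀) (H46 U₀) C₂ (κ_f • ιA′))`** — lit's `Emap H̃ C̃ εC` (the `HD(A′)` inside `W80 … H̃ C̃ εC …`) read on the route's bonds in
exponent units IS `H46` of the EX display's `Dfix`, under the Sect. C regime of `(H̃, C̃)`, both B13 regimes, the nesting windows `4C₂′bε′² ≤ εC`, `4C₂′ε′² ≤ 4C₂ε²`, and the radii.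
[cite: Balaban1985Variational, (47)–(49) p.285, (55) p.286, (80) p.290, Prop. 6 p.295] -/
theorem smul_iota_Emap_eq_H46_Dfix {b C₂ᵣ c₄ aC εC C₂ R b₂ ε C₂' R' ε' : ℝ}
    (RC : Regime (H1f F n K h c₀ cB a (DeltaPiSlot F n K h c₀ cB a) U₀) 0
      (fun A' : Space115 (F.L : ℝ) (((F.L : ℝ)⁻¹) ^ (K - n)) (fun _ : Bond 3 (periodsT3 F K) => K - n)
        (fun _ : Bond 3 (periodsT3 F K) × Fin 3 => K - n) (nabla115 (((F.L : ℝ)⁻¹) ^ (K - n)) (bgOfCfg F K U₀)) =>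
          (-Complex.I) • CmapTwS F n K h U₀ (((((eta F n K : ℝ) : ℂ)) * Complex.I) • fun b : PBond (F.P K) 0 => JetSup.equiv _ _ _ A' (bondEquiv F K b)))
      b 0 C₂ᵣ c₄ 0 aC εC)
    (hC : QuadAnalytic (CmapTwS F n K h U₀) C₂ R) (hC₂ : 0 ≤ C₂) (hb₂ : 0 ≤ b₂) (hHop : ∀ X, ‖H46 F n K h c₀ cB a U₀ X‖ ≤ b₂ * ‖X‖)
    (hq : 9 * C₂ * b₂ * ε < 1) (hRC : 3 * ε ≤ R)
    (hC' : QuadAnalytic (fun A' : Space115 (F.L : ℝ) (((F.L : ℝ)⁻¹) ^ (K - n)) (fun _ : Bond 3 (periodsT3 F K) => K - n)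
        (fun _ : Bond 3 (periodsT3 F K) × Fin 3 => K - n) (nabla115 (((F.L : ℝ)⁻¹) ^ (K - n)) (bgOfCfg F K U₀)) =>
          (-Complex.I) • CmapTwS F n K h U₀ (((((eta F n K : ℝ) : ℂ)) * Complex.I) • fun b : PBond (F.P K) 0 => JetSup.equiv _ _ _ A' (bondEquiv F K b))) C₂' R')
    (hC₂' : 0 ≤ C₂') (hq' : 9 * C₂' * b * ε' < 1) (hRC' : 3 * ε' ≤ R') (hwin : 4 * C₂' * b * ε' ^ 2 ≤ εC) (hnest : 4 * C₂' * ε' ^ 2 ≤ 4 * C₂ * ε ^ 2)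
    {A' : Space115 (F.L : ℝ) (((F.L : ℝ)⁻¹) ^ (K - n)) (fun _ : Bond 3 (periodsT3 F K) => K - n)
        (fun _ : Bond 3 (periodsT3 F K) × Fin 3 => K - n) (nabla115 (((F.L : ℝ)⁻¹) ^ (K - n)) (bgOfCfg F K U₀))}
    (hA'C : ‖A'‖ < aC) (hA' : ‖A'‖ < ε') (hA : ‖((((eta F n K : ℝ) : ℂ)) * Complex.I) • (fun b : PBond (F.P K) 0 => JetSup.equiv _ _ _ A' (bondEquiv F K b))‖ < ε) :
    ((((eta F n K : ℝ) : ℂ)) * Complex.I) • (fun b : PBond (F.P K) 0 => JetSup.equiv _ _ _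
        (Emap (H1f F n K h c₀ cB a (DeltaPiSlot F n K h c₀ cB a) U₀)
          (fun A' : Space115 (F.L : ℝ) (((F.L : ℝ)⁻¹) ^ (K - n)) (fun _ : Bond 3 (periodsT3 F K) => K - n)
            (fun _ : Bond 3 (periodsT3 F K) × Fin 3 => K - n) (nabla115 (((F.L : ℝ)⁻¹) ^ (K - n)) (bgOfCfg F K U₀)) =>
              (-Complex.I) • CmapTwS F n K h U₀ (((((eta F n K : ℝ) : ℂ)) * Complex.I) • fun b : PBond (F.P K) 0 => JetSup.equiv _ _ _ A' (bondEquiv F K b)))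
          εC A') (bondEquiv F K b))
      = H46 F n K h c₀ cB a U₀ (Dfix (CmapTwS F n K h U₀) (H46 F n K h c₀ cB a U₀) C₂
          (((((eta F n K : ℝ) : ℂ)) * Complex.I) • fun b : PBond (F.P K) 0 => JetSup.equiv _ _ _ A' (bondEquiv F K b))) := by
  rw [Emap_eq_Dfix RC hC' hC₂' RC.B₀_nonneg RC.norm_G hq' hRC' hwin hA'C hA', smul_iota_H1f_eq_H46_smul,
    smul_iota_Dfix_eq F n K h c₀ cB a U₀ hC hC₂ hb₂ hHop hq hRC hC' hC₂' RC.B₀_nonneg RC.norm_G hq' hRC' hnest hA' hA]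

/-- ★★★ **«EMAP-DFIX» (b): `κ_f • ι(T47 A′) = χ(κ_f • ιA′)` with S9's chart `χ X := X − H46 U₀ (Dfix (CmapTwS U₀) (H46 U₀) C₂ X)`** — lit's Sect. C chart `T47 H̃ C̃ εC` (the `A = A′ − HD(A′)` of (47) that
`W80` differentiates through) read in exponent units IS the EX display's chart evaluated at `X := κ_f • ιA′` (same hypotheses as (a)).
[cite: Balaban1985Variational, (47)–(49) p.285, (55) p.286, (80) p.290, Prop. 6 p.295] -/
theorem smul_iota_T47_eq_chart {b C₂ᵣ c₄ aC εC C₂ R b₂ ε C₂' R' ε' : ℝ}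
    (RC : Regime (H1f F n K h c₀ cB a (DeltaPiSlot F n K h c₀ cB a) U₀) 0
      (fun A' : Space115 (F.L : ℝ) (((F.L : ℝ)⁻¹) ^ (K - n)) (fun _ : Bond 3 (periodsT3 F K) => K - n)
        (fun _ : Bond 3 (periodsT3 F K) × Fin 3 => K - n) (nabla115 (((F.L : ℝ)⁻¹) ^ (K - n)) (bgOfCfg F K U₀)) =>
          (-Complex.I) • CmapTwS F n K h U₀ (((((eta F n K : ℝ) : ℂ)) * Complex.I) • fun b : PBond (F.P K) 0 => JetSup.equiv _ _ _ A' (bondEquiv F K b)))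
      b 0 C₂ᵣ c₄ 0 aC εC)
    (hC : QuadAnalytic (CmapTwS F n K h U₀) C₂ R) (hC₂ : 0 ≤ C₂) (hb₂ : 0 ≤ b₂) (hHop : ∀ X, ‖H46 F n K h c₀ cB a U₀ X‖ ≤ b₂ * ‖X‖)
    (hq : 9 * C₂ * b₂ * ε < 1) (hRC : 3 * ε ≤ R)
    (hC' : QuadAnalytic (fun A' : Space115 (F.L : ℝ) (((F.L : ℝ)⁻¹) ^ (K - n)) (fun _ : Bond 3 (periodsT3 F K) => K - n)
        (fun _ : Bond 3 (periodsT3 F K) × Fin 3 => K - n) (nabla115 (((F.L : ℝ)⁻¹) ^ (K - n)) (bgOfCfg F K U₀)) =>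
          (-Complex.I) • CmapTwS F n K h U₀ (((((eta F n K : ℝ) : ℂ)) * Complex.I) • fun b : PBond (F.P K) 0 => JetSup.equiv _ _ _ A' (bondEquiv F K b))) C₂' R')
    (hC₂' : 0 ≤ C₂') (hq' : 9 * C₂' * b * ε' < 1) (hRC' : 3 * ε' ≤ R') (hwin : 4 * C₂' * b * ε' ^ 2 ≤ εC) (hnest : 4 * C₂' * ε' ^ 2 ≤ 4 * C₂ * ε ^ 2)
    {A' : Space115 (F.L : ℝ) (((F.L : ℝ)⁻¹) ^ (K - n)) (fun _ : Bond 3 (periodsT3 F K) => K - n)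
        (fun _ : Bond 3 (periodsT3 F K) × Fin 3 => K - n) (nabla115 (((F.L : ℝ)⁻¹) ^ (K - n)) (bgOfCfg F K U₀))}
    (hA'C : ‖A'‖ < aC) (hA' : ‖A'‖ < ε') (hA : ‖((((eta F n K : ℝ) : ℂ)) * Complex.I) • (fun b : PBond (F.P K) 0 => JetSup.equiv _ _ _ A' (bondEquiv F K b))‖ < ε) :
    ((((eta F n K : ℝ) : ℂ)) * Complex.I) • (fun b : PBond (F.P K) 0 => JetSup.equiv _ _ _
        (T47 (H1f F n K h c₀ cB a (DeltaPiSlot F n K h c₀ cB a) U₀)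
          (fun A' : Space115 (F.L : ℝ) (((F.L : ℝ)⁻¹) ^ (K - n)) (fun _ : Bond 3 (periodsT3 F K) => K - n)
            (fun _ : Bond 3 (periodsT3 F K) × Fin 3 => K - n) (nabla115 (((F.L : ℝ)⁻¹) ^ (K - n)) (bgOfCfg F K U₀)) =>
              (-Complex.I) • CmapTwS F n K h U₀ (((((eta F n K : ℝ) : ℂ)) * Complex.I) • fun b : PBond (F.P K) 0 => JetSup.equiv _ _ _ A' (bondEquiv F K b)))
          εC A') (bondEquiv F K b))
      = ((((eta F n K : ℝ) : ℂ)) * Complex.I) • (fun b : PBond (F.P K) 0 => JetSup.equiv _ _ _ A' (bondEquiv F K b))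
          - H46 F n K h c₀ cB a U₀ (Dfix (CmapTwS F n K h U₀) (H46 F n K h c₀ cB a U₀) C₂
              (((((eta F n K : ℝ) : ℂ)) * Complex.I) • fun b : PBond (F.P K) 0 => JetSup.equiv _ _ _ A' (bondEquiv F K b))) := by
  have hE := smul_iota_Emap_eq_H46_Dfix F n K h c₀ cB a U₀ RC hC hC₂ hb₂ hHop hq hRC hC' hC₂' hq' hRC' hwin hnest hA'C hA' hA
  have hT : ∀ b : PBond (F.P K) 0, JetSup.equiv _ _ _ (T47 (H1f F n K h c₀ cB a (DeltaPiSlot F n K h c₀ cB a) U₀)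
      (fun A' : Space115 (F.L : ℝ) (((F.L : ℝ)⁻¹) ^ (K - n)) (fun _ : Bond 3 (periodsT3 F K) => K - n)
        (fun _ : Bond 3 (periodsT3 F K) × Fin 3 => K - n) (nabla115 (((F.L : ℝ)⁻¹) ^ (K - n)) (bgOfCfg F K U₀)) =>
          (-Complex.I) • CmapTwS F n K h U₀ (((((eta F n K : ℝ) : ℂ)) * Complex.I) • fun b : PBond (F.P K) 0 => JetSup.equiv _ _ _ A' (bondEquiv F K b)))
      εC A') (bondEquiv F K b)
      = JetSup.equiv _ _ _ A' (bondEquiv F K b) - JetSup.equiv _ _ _ (Emap (H1f F n K h c₀ cB a (DeltaPiSlot F n K h c₀ cB a) U₀)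
          (fun A' : Space115 (F.L : ℝ) (((F.L : ℝ)⁻¹) ^ (K - n)) (fun _ : Bond 3 (periodsT3 F K) => K - n)
            (fun _ : Bond 3 (periodsT3 F K) × Fin 3 => K - n) (nabla115 (((F.L : ℝ)⁻¹) ^ (K - n)) (bgOfCfg F K U₀)) =>
              (-Complex.I) • CmapTwS F n K h U₀ (((((eta F n K : ℝ) : ℂ)) * Complex.I) • fun b : PBond (F.P K) 0 => JetSup.equiv _ _ _ A' (bondEquiv F K b)))
          εC A') (bondEquiv F K b) := fun b => by
    rw [Emap_eq_sub, JetSup.equiv_sub, Pi.sub_apply, sub_sub_cancel]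
  rw [← hE]
  funext b
  simp only [Pi.smul_apply, Pi.sub_apply, hT, smul_sub]

end Summit.QuantumFields.YangMills.Theorems.Prop7SectET3WChartConj

end
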